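import Literature.Probability.RandomPlanarGeometry.SAWCountZdSymbolTopCount
import HarnessLib

/-!
# ★★★ THE LEADING COEFFICIENT OF THE SYMBOL POLYNOMIAL: `coeff_{X^{2j−3}} R_j = 2^{−j}/(j−2)!` and `natDegree R_j = 2j − 3` for every `j ≥ 2`

Topic `Literature/Probability/RandomPlanarGeometry` (car λ «LEADING SHAPE COEFFICIENT», part 4 of 4 — the assembly; on `SAWCountZdSymbolTopCount.lean` and
`SAWCountZdSymbolPolynomiality.lean` (`symbolPoly`, `shapeClass_eq_empty`), `SAWCountZdSymbolDegree.lean` (η)).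

PRINTED CONTEXT (locators only; nothing is quoted digit-for-digit). Madras–Slade (1993) §1.1 eq. (1.1.8) p. 5 (the `1/d` expansion of `μ` after
Fisher–Sykes / Fisher–Gaunt, "although there is no rigorous control of their error term"), Definition 1.2.4, §1.2 p. 10; Clisby–Liang–Slade (2007) §3.3
eqs. (29)/(31) (enumerations decomposed by the number of dimensions explored). NOT IN PRINT as far as the lane's desks could locate (lit-1 g30 / lit-2 g31,
2026-08-27; FINDING-ZD-SYMBOL-POLYNOMIALITY §6(b)): the statements below (lane theorems about the lane's own symbol polynomial `R_j = symbolPoly j` of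
`SAWCountZdSymbolPolynomiality.lean`, a-p1 g22, and its shape classes `shapeClass j u A` of `SAWCountZdRepeatSetShapes.lean`).

THE THEOREM. `R_j = symbolPoly j` is the polynomial with `#T_j(n) = 2^n R_j(n)` (`n ≥ 2j − 1`) for the canonical reversal-free step words of length `n`
with `n − j` axes and a repeat — the census behind the `j`-th `1/d`-symbol `[d^{n−j}] c_n(ℤ^d)` (`card_badSlice_eq_pow_mul_eval`, a-p1 g22). η (a-p1 g23) gave
`natDegree R_j ≤ 2j − 3`. HERE, for every `j ≥ 2`: ★ `coeff_symbolPoly_top` — the `X^{2j−3}` coefficient is the single shape sum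
`S_j · 2^{−2j}/(2j−3)!`, `S_j = topShapeSum j = Σ_{A valid, breaks A = 2j−3} #shapeClass j (2j) A` (only `u = 2j` reaches the degree; the composed Pochhammer
is monic); ★★ `topShapeSum_eq` — `S_j = (2j − 3) · (2j − 5)‼ · 2^{2j−2}` (parts 1–3: the classes are the `topVec (2j) p`, `p ≤ 2j − 4`, each of size
`(2j−5)‼ · 2^{2j−2}`); ★★★ `coeff_symbolPoly_two_mul_sub_three` — **`coeff_{X^{2j−3}} R_j = (1/2)^j / (j−2)!`**, i.e. `S_j = 2^j (2j−3)!/(j−2)! = M_j(2j, 2j−3)`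
(`4, 48, 960, 26 880, 967 680, 42 577 920` for `j = 2 … 7`: the tops of CAR M, (L1′), (L1″), FINDING-ZD-SYMBOL-POLYNOMIALITY §10/§11 — the lane's conjecture
«LEADING SHAPE COEFFICIENT» (§11), now a theorem for ALL `j`); ★★★ `natDegree_symbolPoly` — `natDegree R_j = 2j − 3` EXACTLY (η is sharp): the
`2^{−n}`-normalised bad-word census `b_j(n) = 2^j R_j(n)` of every order `j` has leading term `n^{2j−3}/(j−2)!`.
Tool notion (the lane's): `topShapeSum`.

THIS FILE (lane «pcv-sawmu», a-p1 g25; all PROVED, standard axioms): `topShapeSum`, `coeff_symbolPoly_term_eq_zero`, `coeff_symbolPoly_term_top`,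
★ `coeff_symbolPoly_top`, ★★ `topShapeSum_eq`, `two_mul_add_one_mul_doubleFactorial`, ★★★ `coeff_symbolPoly_two_mul_sub_three`, ★★★ `natDegree_symbolPoly`.
[cite: MadrasSlade1993, §1.1 eq. (1.1.8) p. 5; Definition 1.2.4; §1.2 (p. 10)] [cite: ClisbyLiangSlade2007, §3.3 eqs. (29)/(31)]

Provenance: lane «pcv-sawmu», a-p1 g25 (2026-08-28).
-/

open Finset
open scoped BigOperators
open Literature.Probability.LatticeModels
open Literature.Probability.RandomPlanarGeometry.SAW
open Literature.Probability.Percolation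

namespace Literature.Probability.RandomPlanarGeometry.SAW.Zd

namespace WordTypes

variable {u : ℕ}

open Classical in
/-- The TOP SHAPE SUM `S_j = Σ_{A valid, breaks A = 2j − 3} #shapeClass_j(2j, A)`: the shape classes on `2j` letters with the maximal number
`2j − 3` of runs. [cite: MadrasSlade1993, Definition 1.2.4; lane tool notion] -/
noncomputable def topShapeSum (j : ℕ) : ℕ :=
  ∑ A : Fin (2 * j) → Bool, if AdjValid A ∧ breaks A = 2 * j - 3 then (shapeClass j (2 * j) A).card else 0

open Classical Polynomial in
/-- A term of `symbolPoly j` off the top corner `(u, breaks) = (2j, 2j − 3)` has no `X^{2j−3}` coefficient.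
[cite: MadrasSlade1993, Definition 1.2.4; lane plumbing] -/
theorem coeff_symbolPoly_term_eq_zero (j u : ℕ) (A : Fin u → Bool) (hj : 2 ≤ j) (h : ¬ (u = 2 * j ∧ breaks A = 2 * j - 3)) :
    (Polynomial.C (((shapeClass j u A).card : ℚ) * (1 / 2) ^ u / ((breaks A).factorial : ℚ)) *
        (descPochhammer ℚ (breaks A)).comp (Polynomial.X + Polynomial.C ((1 : ℚ) - u))).coeff (2 * j - 3) = 0 := by
  by_cases hne : (shapeClass j u A).card = 0
  · rw [hne]; simp
  · obtain ⟨κ, hκ⟩ := Finset.card_pos.1 (Nat.pos_of_ne_zero hne)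
    have h3 := breaks_add_three_le_of_mem_shapeClass hκ
    have hu2 : u ≤ 2 * j := by
      by_contra h'
      rw [shapeClass_eq_empty j u A (by omega)] at hκ
      simp at hκ
    apply Polynomial.coeff_eq_zero_of_natDegree_lt
    refine lt_of_le_of_lt ((Polynomial.natDegree_C_mul_le _ _).trans Polynomial.natDegree_comp_le) ?_
    rw [descPochhammer_natDegree, Polynomial.natDegree_X_add_C, mul_one]
    omega

open Classical Polynomial in
/-- The top-corner term `(u, breaks) = (2j, 2j − 3)`: its `X^{2j−3}` coefficient is `#shapeClass · 2^{−2j}/(2j−3)!` (the composed Pochhammer is monic).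
[cite: MadrasSlade1993, Definition 1.2.4; lane plumbing] -/
theorem coeff_symbolPoly_term_top (j : ℕ) (A : Fin (2 * j) → Bool) (hb : breaks A = 2 * j - 3) :
    (Polynomial.C (((shapeClass j (2 * j) A).card : ℚ) * (1 / 2) ^ (2 * j) / ((breaks A).factorial : ℚ)) *
        (descPochhammer ℚ (breaks A)).comp (Polynomial.X + Polynomial.C ((1 : ℚ) - (2 * j : ℕ)))).coeff (2 * j - 3)
      = ((shapeClass j (2 * j) A).card : ℚ) * (1 / 2) ^ (2 * j) / ((2 * j - 3).factorial : ℚ) := by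
  rw [Polynomial.coeff_C_mul, hb]
  set p : Polynomial ℚ := (descPochhammer ℚ (2 * j - 3)).comp (Polynomial.X + Polynomial.C ((1 : ℚ) - (2 * j : ℕ))) with hp
  have hmon : p.Monic := (monic_descPochhammer ℚ _).comp_X_add_C _
  have hdeg : p.natDegree = 2 * j - 3 := by
    rw [hp, Polynomial.natDegree_comp, descPochhammer_natDegree, Polynomial.natDegree_X_add_C, mul_one]
  have hc : p.coeff (2 * j - 3) = 1 := by
    have := hmon.coeff_natDegree
    rwa [hdeg] at this
  rw [hc, mul_one]

open Classical Polynomial in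
/-- ★ THE TOP COEFFICIENT OF THE SYMBOL POLYNOMIAL IS A SINGLE SHAPE SUM: for `j ≥ 2`,
`coeff_{X^{2j−3}} R_j = S_j · 2^{−2j} / (2j−3)!` with `S_j = topShapeSum j` — only the classes on `u = 2j` letters with `2j − 3` runs reach the
degree bound `2j − 3` of `natDegree_symbolPoly_le_sub_three`. [cite: MadrasSlade1993, §1.1 eq. (1.1.8) p. 5; Definition 1.2.4]
[cite: ClisbyLiangSlade2007, §3.3 eqs. (29)/(31); lane theorem] -/
theorem coeff_symbolPoly_top (j : ℕ) (hj : 2 ≤ j) :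
    (symbolPoly j).coeff (2 * j - 3) = (topShapeSum j : ℚ) * (1 / 2) ^ (2 * j) / ((2 * j - 3).factorial : ℚ) := by
  unfold symbolPoly topShapeSum
  rw [Polynomial.finsetSum_coeff, Finset.sum_range_succ, Finset.sum_eq_zero, zero_add, Polynomial.finsetSum_coeff]
  · -- the `u = 2j` slice
    rw [Nat.cast_sum, Finset.sum_mul, Finset.sum_div]
    refine Finset.sum_congr rfl fun A _ => ?_
    by_cases hv : AdjValid A
    · by_cases hb : breaks A = 2 * j - 3
      · rw [if_pos hv, if_pos ⟨hv, hb⟩, coeff_symbolPoly_term_top j A hb]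
      · rw [if_pos hv, if_neg (fun h => hb h.2), coeff_symbolPoly_term_eq_zero j (2 * j) A hj (fun h => hb h.2)]
        simp
    · rw [if_neg hv, if_neg (fun h => hv h.1)]
      simp
  · -- the slices `u < 2j` vanish
    intro u hu
    have hu' : u < 2 * j := Finset.mem_range.1 hu
    rw [Polynomial.finsetSum_coeff]
    refine Finset.sum_eq_zero fun A _ => ?_
    by_cases hv : AdjValid A
    · rw [if_pos hv]
      exact coeff_symbolPoly_term_eq_zero j u A hj (fun h => by omega)
    · rw [if_neg hv]; simp

/-! ### Assembly: the top shape sum and the top coefficient of `R_j` -/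

section Assembly

open Classical in
/-- ★★ THE TOP SHAPE SUM: `S_j = (2j − 3) · (2j − 5)‼ · 2^{2j−2}` (`j ≥ 2`): `2j − 3` positions of the block, `(2j−5)‼` matchings of the other
letters, `2^{2j−2}` signs. [cite: MadrasSlade1993, Definition 1.2.4; lane theorem] -/
theorem topShapeSum_eq (j : ℕ) (hj : 2 ≤ j) :
    topShapeSum j = (2 * j - 3) * ((2 * j - 5).doubleFactorial * 2 ^ (2 * j - 2)) := by
  unfold topShapeSum
  have hval : ∀ p ∈ Finset.range (2 * j - 3),
      (if AdjValid (topVec (2 * j) p) ∧ breaks (topVec (2 * j) p) = 2 * j - 3 then (shapeClass j (2 * j) (topVec (2 * j) p)).card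
        else 0) = (2 * j - 5).doubleFactorial * 2 ^ (2 * j - 2) := by
    intro p hp
    rw [Finset.mem_range] at hp
    have hp4 : p + 4 ≤ 2 * j := by omega
    rw [if_pos ⟨adjValid_topVec hp4, by rw [breaks_topVec hp4]⟩, card_shapeClass_top hp4]
  have hvan : ∀ A ∈ (Finset.univ : Finset (Fin (2 * j) → Bool)), A ∉ (Finset.range (2 * j - 3)).image (topVec (2 * j)) →
      (if AdjValid A ∧ breaks A = 2 * j - 3 then (shapeClass j (2 * j) A).card else 0) = 0 := by
    intro A _ hA
    split_ifs with h
    · by_contra hne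
      obtain ⟨κ, hκ⟩ := Finset.card_pos.1 (Nat.pos_of_ne_zero hne)
      obtain ⟨p, hp4, rfl⟩ := exists_eq_topVec_of_mem_shapeClass (by rw [h.2]; omega) hκ
      exact hA (Finset.mem_image.2 ⟨p, Finset.mem_range.2 (by omega), rfl⟩)
    · rfl
  have hinj : Set.InjOn (topVec (2 * j)) ↑(Finset.range (2 * j - 3)) := by
    intro p hp p' hp' h
    rw [Finset.mem_coe, Finset.mem_range] at hp hp'
    exact topVec_injOn (by omega) (by omega) h
  rw [← Finset.sum_subset (Finset.subset_univ _) hvan, Finset.sum_image hinj, Finset.sum_congr rfl hval, Finset.sum_const,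
    Finset.card_range, smul_eq_mul]

/-- The double-factorial bookkeeping: `(2k+1)·(2k−1)‼ = (2k+1)‼`. [cite: MadrasSlade1993, §1.1 eq. (1.1.8) p. 5; lane plumbing] -/
theorem two_mul_add_one_mul_doubleFactorial (k : ℕ) : (2 * k + 1) * (2 * k - 1).doubleFactorial = (2 * k + 1).doubleFactorial := by
  cases k with
  | zero => decide
  | succ k =>
    rw [show 2 * (k + 1) - 1 = 2 * k + 1 by omega, show 2 * (k + 1) + 1 = 2 * k + 1 + 2 by omega, Nat.doubleFactorial_add_two]

/-- ★★★ THE LEADING COEFFICIENT OF THE SYMBOL POLYNOMIAL: for every `j ≥ 2`,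
`coeff_{X^{2j−3}} R_j = 2^{−j} / (j − 2)!` — the lane's conjecture «LEADING SHAPE COEFFICIENT» (FINDING-ZD-SYMBOL-POLYNOMIALITY §11: the tops
`M_j(2j, 2j−3) = 2^j (2j−3)!/(j−2)!` of the kernel censuses `j = 4, 5, 6` and of kit j291072 at `j = 7`) for ALL `j`: the `2^{−n}`-normalised bad-word
census `b_j(n) = 2^j R_j(n)` has leading term `n^{2j−3}/(j−2)!`, and `natDegree_symbolPoly_le_sub_three` is sharp.
[cite: MadrasSlade1993, §1.1 eq. (1.1.8) p. 5; Definition 1.2.4] [cite: ClisbyLiangSlade2007, §3.3 eqs. (29)/(31); lane theorem] -/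
theorem coeff_symbolPoly_two_mul_sub_three (j : ℕ) (hj : 2 ≤ j) :
    (symbolPoly j).coeff (2 * j - 3) = (1 / 2) ^ j / ((j - 2).factorial : ℚ) := by
  rw [coeff_symbolPoly_top j hj, topShapeSum_eq j hj]
  obtain ⟨k, rfl⟩ : ∃ k, j = k + 2 := ⟨j - 2, by omega⟩
  have e1 : 2 * (k + 2) - 3 = 2 * k + 1 := by omega
  have e2 : 2 * (k + 2) - 5 = 2 * k - 1 := by omega
  have e3 : 2 * (k + 2) - 2 = 2 * k + 2 := by omega
  have e4 : k + 2 - 2 = k := by omega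
  rw [e1, e2, e3, e4, ← mul_assoc, two_mul_add_one_mul_doubleFactorial k, Nat.factorial_eq_mul_doubleFactorial,
    Nat.doubleFactorial_two_mul]
  have hD : ((2 * k + 1).doubleFactorial : ℚ) ≠ 0 := by exact_mod_cast (Nat.doubleFactorial_pos _).ne'
  have hk : (k.factorial : ℚ) ≠ 0 := by exact_mod_cast k.factorial_ne_zero
  push_cast
  simp only [one_div, inv_pow]
  field_simp
  ring

/-- ★★★ Hence `natDegree R_j = 2j − 3` EXACTLY for every `j ≥ 2` (η's bound is attained). [cite: MadrasSlade1993, §1.1 eq. (1.1.8) p. 5; Definition 1.2.4]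
[cite: ClisbyLiangSlade2007, §3.3 eqs. (29)/(31); lane theorem] -/
theorem natDegree_symbolPoly (j : ℕ) (hj : 2 ≤ j) : (symbolPoly j).natDegree = 2 * j - 3 := by
  refine le_antisymm (natDegree_symbolPoly_le_sub_three j) (Polynomial.le_natDegree_of_ne_zero ?_)
  rw [coeff_symbolPoly_two_mul_sub_three j hj]
  have hk : ((j - 2).factorial : ℚ) ≠ 0 := by exact_mod_cast (j - 2).factorial_ne_zero
  positivity

end Assembly

end WordTypes

end Literature.Probability.RandomPlanarGeometry.SAW.Zd
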